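import Literature.MathematicalPhysics.QuantumFieldTheory.Balaban1983to89.B8Prop6CubeMemberRec
import Literature.MathematicalPhysics.QuantumFieldTheory.Balaban1983to89.B8Ineq133CubeMemberGamma

/-!
# `Balaban1983to89.B8Ineq133CubeMemberGammaRec` — [Balaban1985RegularSpaces] (1.133) ON THE WHOLE OF `□̃` and the p. 99 sentence «the assumptions of Theorem 4 are satisfied for the
# pair 1, U₀″» IN PRINT's GUARD «box ⊂ □_{j−1}» (edition γ), FOR THE RECORD's CENTRED TOWER ([Balaban1987RG1] (0.3)–(0.4)) — the record twin of `B8Ineq133CubeMemberGamma` (R6 (b);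
# LEAD PEN dag-n05-e)

statement-level skeleton of published theorems with citation tags; proofs where landed; nothing here is a claim about the Yang–Mills mass gap

CITATION HEADER (lean-in-tree rule).  Cell `pub-ymgap` (HUMAN RULING D-0062), «N05-REC» road (director-ym №254∕№255; LEAD PEN dag-n05-e g37; desk `R6-PLAN.md` §2 (b); `N05-REC-INVENTORY.md` §R6
row `B8Ineq133CubeMemberGamma — A: thm4_hypotheses_one_cutFixed_γ, h135_cutFixed_γ, h135_cutFixed_tcube, norm_avgIter_cutFixed_sub_one_lt_of_tcube`).  [6] = [Balaban1985RegularSpaces]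
(1.130)–(1.133) pp. 98–99, (1.20) p. 79, (1.31) p. 82, (1.33)–(1.35) p. 82, (1.66) p. 87, p. 77 (`paper:balaban1985-cmp99-regular-spaces`); [I] = [Balaban1987RG1] (0.3)–(0.4) pp. 252–253.
`--kind proof --supports stmt-QuantumFields-20541` (K0⁷; count-neutral; no definition).  RECORD INPUTS BY NAME: dag-n05-d's `B8Ineq133Rec.ineq133` (sixth clause: (1.133) on every bond of
every depth-`n` cube of the centred tower), `B8Eq119TwistedAxialRec.ctrShift_add`, `B8Ineq130Rec.{tlo_apply, thi_apply}`, `B8Eq131CubesRec.{tcubeZ, cubeZ, cube_subset_tcube}`,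
`B8Eq131CubesAdmissibleRec.cubeFam_false_of_le`; the lead's `B8Prop6CubeMemberRec.thm4_hypotheses_one_cutFixedZ`; class-0 `ctr_mem ∕ two_crad_le ∕ tLo_le_tHi ∕ mulCfg`.

WHAT IS PROVED (sorry-free; odd `L = 2s + 1 ≥ 3`).  §1 `ends_le_tilde_of_box_subset_tcubeZ` (a level-`j` bond whose centred fine box lies in `□̃` has both ends in the depth-`(k−j)` cube
`□̃^{(j)}` — `c_k = L^j·c_{k−j} + c_j`); ★ `norm_avgIterZ_cutFixedZ_sub_one_lt_of_tcube` ((1.133) `|Ū₀″ʲ(c) − 1| < 6dL²Mα₀` at EVERY level-`j` bond whose centred box lies in `□̃`);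
`h135_cutFixedZ_tcube`; ★ `h135_cutFixedZ_γ` (print's guard «box ⊂ □_{j−1}», since `□_{j−1} ⊂ □̃`); §2 ★★ `thm4_hypotheses_one_cutFixedZ_γ` (the record's Thm-4 hypothesis package at
`(1, U₀″)` with the (1.35)∕(1.66) conjunct in the γ guard — the currency of the γ driver).
HONEST SCOPE.  Composition by name + centred-box arithmetic; no new estimate; nothing of [6]∕[I] asserted beyond (1.130)–(1.133)'s bookkeeping; `HThm4Rec` UNDISCHARGED; N05 ∕ N07 NOT
discharged; counts unmoved (typed 28∕28 · discharged 8∕28); one finite 𝕋⁴ programme at fixed ε — nothing continuum ∕ ℝ⁴ ∕ OS ∕ mass gap ∕ Clay.  No `def`, no `instance`, no `notation`, no `sorry`.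
-/

noncomputable section

open scoped BigOperators

namespace Literature.MathematicalPhysics.QuantumFieldTheory.Balaban1983to89.B8Ineq133CubeMemberGammaRec

open B7Prop1Explicit B7Prop1Local
open B7Prop2Explicit (pdev c2' unitaryUnits)
open B7Prop2Rec (AvgClosedZ C0Z avgClosedZ_unitaryUnits)
open BlockAveragingZd (avgIterZ avgIterZ_one offZ ctrShift)
open B8Ineq130Rec (tlo thi tlo_apply thi_apply)
open B8Ineq133Rec (cutFixedZ ineq133)
open B8Ineq132 (InAk)
open B8Ineq132Rec (pdevOn_lt_of_inAk_box)
open B8Eq119TwistedAxialRec (InAxZ ctrShift_add)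
open B8Eq140Level (SideTouches)
open B8Eq131Cubes (tLo tHi ctr ctr_mem two_crad_le tLo_le_tHi)
open B8Eq131CubesRec (sqLoZ sqHiZ cubeZ tcubeZ cube_subset_tcube)
open B8Eq131CubesAdmissibleRec (cubeFamZ cubeFam_false_of_le)
open B8Lemma1NonAbelian (mulCfg)
open B8CubeMemberZdRec (cubeLamSZ)
open B8Prop6CubeMemberRec (thm4_hypotheses_one_cutFixedZ)

export B7Prop1Explicit (Site)

variable {d : ℕ}

/-! ## §1 (1.133) at every bond whose centred box lies in `□̃` -/

/-- **A level-`j` bond whose CENTRED fine box lies in `□̃` has both ends in the depth-`(k − j)` cube `□̃^{(j)} = [tlo (k−j), thi (k−j)]`** (`j ≤ k`, odd `L`): the corners of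
`[L^jz − c_j𝟙, L^jz + L^je_μ + c_j𝟙]` lie in `□̃ = [L^k·lo − c_k𝟙, L^k·hi + c_k𝟙]` and `c_k = L^j·c_{k−j} + c_j`. [cite: Balaban1985RegularSpaces, p.98 («□_j is a sum of the big blocks»), (1.133) p.99; Balaban1987RG1, (0.3) p.252] -/
theorem ends_le_tilde_of_box_subset_tcubeZ {L : ℕ} (hLo : Odd L) (a : Site d) (M ρ : ℕ) {k j : ℕ} (hj : j ≤ k) {z : Site d} {μ : Fin d}
    (hbox : ∀ x, InBox (fun i => (L : ℤ) ^ j * z i - (ctrShift L j : ℤ)) (fun i => (L : ℤ) ^ j * z i + (ctrShift L j : ℤ) + if i = μ then (L : ℤ) ^ j else 0) x →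
      x ∈ tcubeZ L a M ρ k) :
    tlo L (tLo a ρ) (k - j) ≤ z ∧ z + e μ ≤ thi L (tHi a M ρ) (k - j) := by
  have hP : (0 : ℤ) < (L : ℤ) ^ j := by have := hLo.pos; positivity
  have hc : (0 : ℤ) ≤ (ctrShift L j : ℤ) := by positivity
  have hck : (ctrShift L k : ℤ) = (L : ℤ) ^ j * ctrShift L (k - j) + ctrShift L j := by
    have h := ctrShift_add hLo (k - j) j
    rwa [Nat.sub_add_cancel hj] at h
  have hLk : (L : ℤ) ^ k = (L : ℤ) ^ j * (L : ℤ) ^ (k - j) := by rw [← pow_add, Nat.add_sub_cancel' hj]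
  have hlo := hbox (fun i => (L : ℤ) ^ j * z i - (ctrShift L j : ℤ)) (fun i => ⟨le_rfl, by
    simp only; split_ifs <;> nlinarith⟩)
  have hhi := hbox (fun i => (L : ℤ) ^ j * z i + (ctrShift L j : ℤ) + if i = μ then (L : ℤ) ^ j else 0) (fun i => ⟨by
    simp only; split_ifs <;> nlinarith, le_rfl⟩)
  simp only [tcubeZ, Set.mem_setOf_eq] at hlo hhi
  constructor
  · intro i
    have h := (hlo i).1
    rw [tlo_apply hLo] at h ⊢
    dsimp only at h
    rw [hck, hLk] at h
    have : (L : ℤ) ^ j * ((L : ℤ) ^ (k - j) * tLo a ρ i - ctrShift L (k - j)) ≤ (L : ℤ) ^ j * z i := by nlinarith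
    exact le_of_mul_le_mul_left this hP
  · intro i
    have h := (hhi i).2
    rw [thi_apply hLo] at h ⊢
    dsimp only at h
    rw [add_e_apply]
    rw [hck, hLk] at h
    have h' : (L : ℤ) ^ j * (z i + (if i = μ then 1 else 0)) ≤ (L : ℤ) ^ j * ((L : ℤ) ^ (k - j) * tHi a M ρ i + ctrShift L (k - j)) := by
      split_ifs at h ⊢ <;> nlinarith
    exact le_of_mul_le_mul_left h' hP

section Analytic

variable {𝔸 : Type*} [NormedRing 𝔸] [NormOneClass 𝔸] [NormedAlgebra ℂ 𝔸] [CompleteSpace 𝔸]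

/-- ★ (RECORD TWIN of `norm_avgIter_cutFixed_sub_one_lt_of_tcube`.) **(1.133) ON THE WHOLE OF `□̃`, record tower**: for every `j ≤ k` and every level-`j` bond `c = ⟨z, z + e_μ⟩` whose centred
fine box lies in `□̃` (print's «□_j ⊂ □̃», the domain where «by the construction of U₀″, and the inequality (1.130)» (1.133) holds): `|Ū₀″ʲ(c) − 1| < 6dL²Mα₀`.  Setting of
`B8Eq131CubesRec.ineq132_cubes`. [cite: Balaban1985RegularSpaces, (1.133) p.99, (1.130) p.98–99; Balaban1987RG1, (0.4) p.253] -/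
theorem norm_avgIterZ_cutFixedZ_sub_one_lt_of_tcube {L s : ℕ} (hLs : L = 2 * s + 1) (hL : 2 ≤ L) (hd : 1 ≤ d) {G : Subgroup 𝔸ˣ} (hG : AvgClosedZ d L G)
    (k : ℕ) (U : Site d → Fin d → 𝔸ˣ) (hU : ∀ x κ, U x κ ∈ G) {α₀ : ℝ} (hα : 0 < α₀)
    (hα3 : C0Z d * (α₀ * (L : ℝ) ^ 2) ≤ 1 / 3) (hα2 : 2 * (α₀ * (L : ℝ) ^ 2) ≤ c2' d L)
    (a : Site d) {M ρ : ℕ} (hρ : 1 ≤ ρ) (hρM : ρ ≤ M) (hM : 11 * (d : ℝ) < M)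
    {η : ℝ} {Ω : ℕ → Set (Site d)} (hA : InAk L k η α₀ Ω U) (hT : tcubeZ L a M ρ k ⊆ Ω (k - 1))
    (hsmall : 11 * (d : ℝ) ^ 2 * (L : ℝ) ^ 2 * α₀ + ((M : ℝ) + 4 * ρ) * d * (L : ℝ) ^ 2 * α₀ ≤ 1 / 6)
    {j : ℕ} (hj : j ≤ k) {z : Site d} {μ : Fin d}
    (hbox : ∀ x, InBox (fun i => (L : ℤ) ^ j * z i - (ctrShift L j : ℤ)) (fun i => (L : ℤ) ^ j * z i + (ctrShift L j : ℤ) + if i = μ then (L : ℤ) ^ j else 0) x →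
      x ∈ tcubeZ L a M ρ k) :
    ‖((avgIterZ L (cutFixedZ L (tLo a ρ) (tHi a M ρ) U k (ctr a M)) j z μ : 𝔸ˣ) : 𝔸) - 1‖ < 6 * d * (L : ℝ) ^ 2 * M * α₀ := by
  have hLo : Odd L := ⟨s, hLs⟩
  have hL1 : 1 ≤ L := le_trans (by norm_num) hL
  have hM1 : 1 ≤ M := hρ.trans hρM
  obtain ⟨hy, hy', hrad⟩ := ctr_mem (a := a) (ρ := ρ) hM1
  have hRM : (ρ : ℝ) * 1 ≤ (M : ℝ) := by rw [mul_one]; exact_mod_cast hρM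
  have hsmall' : 11 * (d : ℝ) ^ 2 * (L : ℝ) ^ 2 * α₀ + ((M : ℝ) + 4 * ρ * 1) * d * (L : ℝ) ^ 2 * α₀ ≤ 1 / 6 := by rwa [mul_one]
  have hΩ : ∃ l, l ≤ k ∧ k ≤ l + 1 ∧ ∀ x, InBox (tlo L (tLo a ρ) k) (thi L (tHi a M ρ) k) x → x ∈ Ω l :=
    ⟨k - 1, Nat.sub_le _ _, by omega, fun x hx => hT hx⟩
  have h17 := pdevOn_lt_of_inAk_box hL1 hα hA hΩ
  obtain ⟨-, -, -, -, -, h6⟩ := ineq133 hLs hL hd hG k U hU hα hα3 hα2 (tLo a ρ) (tHi a M ρ) (tLo_le_tHi hM1) h17 hy hy' hrad (two_crad_le M ρ) hRM hM hsmall'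
  obtain ⟨hlo, hhi⟩ := ends_le_tilde_of_box_subset_tcubeZ hLo a M ρ hj hbox
  have h := h6 (k - j) (Nat.sub_le _ _) z μ hlo hhi
  rwa [Nat.sub_sub_self hj] at h

/-- (RECORD TWIN of `h135_cutFixed_tcube`.) (1.35)∕(1.66) for the pair `(1, U₀″)` at every level-`j` bond whose centred box lies in `□̃`: `‖(U₀″·1)‾ʲ(c) − 1̄ʲ(c)‖ ≤ 6dL²Mα₀` (`1̄ʲ = 1`).
[cite: Balaban1985RegularSpaces, (1.133) p.99, (1.66) p.87, (1.35) p.82, (1.20) p.79; Balaban1987RG1, (0.4) p.253] -/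
theorem h135_cutFixedZ_tcube {L s : ℕ} (hLs : L = 2 * s + 1) (hL : 2 ≤ L) (hd : 1 ≤ d) {G : Subgroup 𝔸ˣ} (hG : AvgClosedZ d L G)
    (k : ℕ) (U : Site d → Fin d → 𝔸ˣ) (hU : ∀ x κ, U x κ ∈ G) {α₀ : ℝ} (hα : 0 < α₀)
    (hα3 : C0Z d * (α₀ * (L : ℝ) ^ 2) ≤ 1 / 3) (hα2 : 2 * (α₀ * (L : ℝ) ^ 2) ≤ c2' d L)
    (a : Site d) {M ρ : ℕ} (hρ : 1 ≤ ρ) (hρM : ρ ≤ M) (hM : 11 * (d : ℝ) < M)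
    {η : ℝ} {Ω : ℕ → Set (Site d)} (hA : InAk L k η α₀ Ω U) (hT : tcubeZ L a M ρ k ⊆ Ω (k - 1))
    (hsmall : 11 * (d : ℝ) ^ 2 * (L : ℝ) ^ 2 * α₀ + ((M : ℝ) + 4 * ρ) * d * (L : ℝ) ^ 2 * α₀ ≤ 1 / 6) :
    ∀ j, j ≤ k → ∀ (z : Site d) (μ : Fin d),
      (∀ x, InBox (fun i => (L : ℤ) ^ j * z i - (ctrShift L j : ℤ)) (fun i => (L : ℤ) ^ j * z i + (ctrShift L j : ℤ) + if i = μ then (L : ℤ) ^ j else 0) x →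
        x ∈ tcubeZ L a M ρ k) →
        ‖(avgIterZ L (mulCfg (cutFixedZ L (tLo a ρ) (tHi a M ρ) U k (ctr a M)) (1 : Site d → Fin d → 𝔸ˣ)) j z μ : 𝔸) -
            (avgIterZ L (1 : Site d → Fin d → 𝔸ˣ) j z μ : 𝔸)‖ ≤ 6 * d * (L : ℝ) ^ 2 * M * α₀ := by
  intro j hj z μ hbox
  have hW1 : mulCfg (cutFixedZ L (tLo a ρ) (tHi a M ρ) U k (ctr a M)) (1 : Site d → Fin d → 𝔸ˣ) = cutFixedZ L (tLo a ρ) (tHi a M ρ) U k (ctr a M) := by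
    funext x ν; simp [mulCfg]
  rw [hW1, avgIterZ_one, Pi.one_apply, Pi.one_apply, Units.val_one]
  exact (norm_avgIterZ_cutFixedZ_sub_one_lt_of_tcube hLs hL hd hG k U hU hα hα3 hα2 a hρ hρM hM hA hT hsmall hj hbox).le

/-- ★ (RECORD TWIN of `h135_cutFixed_γ`.) **THE DRIVER's (1.35)∕(1.66) CLAUSE FOR THE PAIR `(1, U₀″)` IN PRINT's GUARD «box ⊂ □_{j−1}»**, record tower (`□_{j−1} ⊂ □̃`,
`B8Eq131CubesRec.cube_subset_tcube`; ℕ subtraction, level `0` reads `□₀`). [cite: Balaban1985RegularSpaces, (1.133) p.99, (1.35) p.82, (1.31) p.82, p.77, (1.66) p.87; Balaban1987RG1, (0.4) p.253] -/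
theorem h135_cutFixedZ_γ {L s : ℕ} (hLs : L = 2 * s + 1) (hL : 2 ≤ L) (hd : 1 ≤ d) {G : Subgroup 𝔸ˣ} (hG : AvgClosedZ d L G)
    (k : ℕ) (U : Site d → Fin d → 𝔸ˣ) (hU : ∀ x κ, U x κ ∈ G) {α₀ : ℝ} (hα : 0 < α₀)
    (hα3 : C0Z d * (α₀ * (L : ℝ) ^ 2) ≤ 1 / 3) (hα2 : 2 * (α₀ * (L : ℝ) ^ 2) ≤ c2' d L)
    (a : Site d) {M ρ : ℕ} (hρ : 1 ≤ ρ) (hρM : ρ ≤ M) (hM : 11 * (d : ℝ) < M)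
    {η : ℝ} {Ω : ℕ → Set (Site d)} (hA : InAk L k η α₀ Ω U) (hT : tcubeZ L a M ρ k ⊆ Ω (k - 1))
    (hsmall : 11 * (d : ℝ) ^ 2 * (L : ℝ) ^ 2 * α₀ + ((M : ℝ) + 4 * ρ) * d * (L : ℝ) ^ 2 * α₀ ≤ 1 / 6) :
    ∀ j, j ≤ k → ∀ (z : Site d) (μ : Fin d),
      (∀ x, InBox (fun i => (L : ℤ) ^ j * z i - (ctrShift L j : ℤ)) (fun i => (L : ℤ) ^ j * z i + (ctrShift L j : ℤ) + if i = μ then (L : ℤ) ^ j else 0) x →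
        x ∈ cubeFamZ false L a M ρ k (j - 1)) →
        ‖(avgIterZ L (mulCfg (cutFixedZ L (tLo a ρ) (tHi a M ρ) U k (ctr a M)) (1 : Site d → Fin d → 𝔸ˣ)) j z μ : 𝔸) -
            (avgIterZ L (1 : Site d → Fin d → 𝔸ˣ) j z μ : 𝔸)‖ ≤ 6 * d * (L : ℝ) ^ 2 * M * α₀ := by
  have hLo : Odd L := ⟨s, hLs⟩
  intro j hj z μ hbox
  refine h135_cutFixedZ_tcube hLs hL hd hG k U hU hα hα3 hα2 a hρ hρM hM hA hT hsmall j hj z μ fun x hx => ?_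
  have h := hbox x hx
  rw [cubeFam_false_of_le L a M ρ (show j - 1 ≤ k by omega)] at h
  exact cube_subset_tcube hLo hL hρ (show j - 1 ≤ k by omega) h

end Analytic

/-! ## §2 The p. 99 sentence at the cube member in the currency of the γ driver, record tower -/

section Hypotheses

variable {𝔸 : Type*} [CStarAlgebra 𝔸] [Nontrivial 𝔸]

/-- ★★ (RECORD TWIN of `thm4_hypotheses_one_cutFixed_γ`.) **THE p. 99 SENTENCE AT THE CUBE MEMBER IN THE CURRENCY OF THE γ DRIVER, RECORD TOWER**: the six conjuncts of
`B8Prop6CubeMemberRec.thm4_hypotheses_one_cutFixedZ` with the (1.35)∕(1.66) conjunct in PRINT's guard «the centred box of the level-`j` bond lies in `□_{j−1}`» (`h135_cutFixedZ_γ`).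
[cite: Balaban1985RegularSpaces, p.99 (sentence after (1.133)), (1.132)–(1.133) p.99, (1.33)–(1.35) p.82, (1.66) p.87, p.77; Balaban1987RG1, (0.3)–(0.4) pp.252–253] -/
theorem thm4_hypotheses_one_cutFixedZ_γ {L s : ℕ} (hLs : L = 2 * s + 1) (hL : 2 ≤ L) (hd : 1 ≤ d) (k : ℕ)
    (U : Site d → Fin d → 𝔸ˣ) (hU : ∀ x κ, U x κ ∈ unitaryUnits 𝔸) {α₀ : ℝ} (hα : 0 < α₀)
    (hα3 : C0Z d * (α₀ * (L : ℝ) ^ 2) ≤ 1 / 3) (hα2 : 2 * (α₀ * (L : ℝ) ^ 2) ≤ c2' d L)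
    (a : Site d) {M ρ : ℕ} (hρ : 1 ≤ ρ) (hρM : ρ ≤ M) (hM : 11 * (d : ℝ) < M)
    {η : ℝ} (hη : 0 < η) {Ω : ℕ → Set (Site d)} (hA : InAk L k η α₀ Ω U) (hT : tcubeZ L a M ρ k ⊆ Ω (k - 1))
    (hsmall : 11 * (d : ℝ) ^ 2 * (L : ℝ) ^ 2 * α₀ + ((M : ℝ) + 4 * ρ) * d * (L : ℝ) ^ 2 * α₀ ≤ 1 / 6) :
    (∀ x κ, cutFixedZ L (tLo a ρ) (tHi a M ρ) U k (ctr a M) x κ ∈ unitaryUnits 𝔸) ∧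
    InAk L k η ((L : ℝ) ^ 3 * α₀) (cubeFamZ false L a M ρ k) (1 : Site d → Fin d → 𝔸ˣ) ∧
    InAk L k η ((L : ℝ) ^ 3 * α₀) (cubeFamZ false L a M ρ k) (mulCfg (cutFixedZ L (tLo a ρ) (tHi a M ρ) U k (ctr a M)) (1 : Site d → Fin d → 𝔸ˣ)) ∧
    (∀ m, m ≤ k → InAxZ L m (cubeLamSZ L a M ρ k m) (1 : Site d → Fin d → 𝔸ˣ) (mulCfg (cutFixedZ L (tLo a ρ) (tHi a M ρ) U k (ctr a M)) (1 : Site d → Fin d → 𝔸ˣ))) ∧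
    (∀ j, j ≤ k → ∀ (z : Site d) (μ : Fin d),
      (∀ x, InBox (fun i => (L : ℤ) ^ j * z i - (ctrShift L j : ℤ)) (fun i => (L : ℤ) ^ j * z i + (ctrShift L j : ℤ) + if i = μ then (L : ℤ) ^ j else 0) x →
        x ∈ cubeFamZ false L a M ρ k (j - 1)) →
        ‖(avgIterZ L (mulCfg (cutFixedZ L (tLo a ρ) (tHi a M ρ) U k (ctr a M)) (1 : Site d → Fin d → 𝔸ˣ)) j z μ : 𝔸) - (avgIterZ L (1 : Site d → Fin d → 𝔸ˣ) j z μ : 𝔸)‖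
          ≤ 6 * d * (L : ℝ) ^ 2 * M * α₀) ∧
    (∀ (x : Site d) (ν : Fin d), ‖((cutFixedZ L (tLo a ρ) (tHi a M ρ) U k (ctr a M) x ν : 𝔸ˣ) : 𝔸) - 1‖ ≤ 6 * d * (L : ℝ) ^ 2 * M * α₀) := by
  obtain ⟨hmem, h33, h34, hAx, -, h66⟩ := thm4_hypotheses_one_cutFixedZ hLs hL hd k U hU hα hα3 hα2 a hρ hρM hM hη hA hT hsmall
  exact ⟨hmem, h33, h34, hAx, h135_cutFixedZ_γ hLs hL hd (avgClosedZ_unitaryUnits (𝔸 := 𝔸) d L) k U hU hα hα3 hα2 a hρ hρM hM hA hT hsmall, h66⟩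

end Hypotheses

end Literature.MathematicalPhysics.QuantumFieldTheory.Balaban1983to89.B8Ineq133CubeMemberGammaRec
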